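import Summits.QuantumFields.BalabanUV.T4Continuum.Support.VariationalColourScalarPairClosed
import Summits.QuantumFields.BalabanUV.T4Continuum.Support.VariationalColourTaxiTowerLeaves

/-!
# T⁴ programme, spine node NE2 (U1a), lane P2 — THE COLOUR SCALAR PAIR's FIVE LEAVES (UB⁺, fine UB⁺, P⁺ ×2, REG⁺) AS A BUNDLE FROM DATA, AND AT BAŁABAN's TAXI FRAMES
# (item «ONE-MIN AT TAXI DATA — THE COMPOSITE-FIBRE ↔ TAXI-FRAME BRIDGE», file 7 — the supplier of the courier's displayed colour leaves; model level; cell `pub-balaban`)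

NE2 formalisation swarm `b2b-balaban-t4-ne2-formalise-*`, leaf prover 04 GEN 7 (`prover-b2b-balaban-t4-ne2-formalise-leaf-04-g7-0`); register row «P2-sup» of
`t4/formal/NE2/LEAVES.md`; journal CLAIMS.log INTENT 2026-08-20 l.21025, courier LANDED l.22267.  §1 is leaf-02-g5's `VariationalColourScalarPairClosed.colour_pair_closed`
(p-lineage «V-COL-CLOSED») `have`-chain EXPORTED as a statement — `hUBc_colour` (leaf-03-g4's UB⁺-colour), `qWv_le_coarse_local` ∕ `qVv_le_composite_local` (leaf-02-g4's
local colour P⁺), `blockSpin_Q1v_le` (ONE⁺-colour) → `fine_ub_of_coarse_sqrt` (leaf-01-g2's abstract fine UB⁺), `hREG_rhov` (REG⁺-colour) — BY NAME, nothing re-proved;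
§2 reads it at the taxi frames with gen 4's taxi classes (`inBlock_defect_taxiTv_adjoint_le`, `norm_misv_taxi_le`, `hin_taxiTv_le`, `hcross_taxiTv_le`, part 10's
`inBlock_blockOf_of_bpt`).  Nothing defined.

 * §1 **`colour_leaves`** (general finite-dimensional Hilbert `E`; DATA exactly as in `colour_pair_closed`): the conjunction `0 ≤ Λ ∧ 0 ≤ C_R ∧ hUBc ∧ hUBf ∧ hPc ∧ hPf ∧ hREG`
   with `Λc = 2d·36^d((1 + n w)² + 9)`, `C_P = 136`, `C_R = 2Λc + 2d(a n²) + d²(a n²)²·136`, `ε₁ = (d∕4 + ½)(L∕n²)`, `δ′ = √(2d(1+d²))·(n L m₁)`,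
   `Λ = Λc + (ε₁C_R + 2δ′√((1+ε₁C_R)C_P) + δ′²C_P)(Λc + 1)` — the five leaves in the letters of leaf-01-g9's `hONEm_centred_reg` (`Qkv`, `Q1v`, `Scv`, `Sfv`, `qWv`, `qVv`, `rhov`).
 * §2 **`colour_leaves_taxi`** (`E = ℂ`, coherent tower of unitary one-step bonds): the same at `T := taxiTv (L^k) M (Rlev k)`, `T′ := taxiTv L _ (R′ k)`, `Rc := Rlev k`,
   `R′ := R′ k`, with `w = (d−1)(L^k−1)a`, `w′ = (d−1)(L−1)b_k`, `m = (d−1)L(L−1)b_k`, `m₁ = (d−1)(L−1)(2L−1)b_k` — exactly the displayed colour leaves of the courier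
   `VariationalColourTaxiTowerCentred.hONEm_taxi` (p238755); displayed: the three local small-field absorptions `2d(L^k w)² ≤ ½`, `2d(L w′)² ≤ ½`, `64d(L^k m)² ≤ ½` and `1 < M_μ`.

HONEST FRAMING (T4-DAG p. 1).  Rung (B)+1 only — NOT infinite volume, NOT a mass gap, NOT Clay.  NE2 NOT IN PRINT, NOT proved here.  MODEL LEVEL (c5): operators DATA, taxi
contours OURS; [folklore] composition of landed leaves; thresholds k-uniform under the class but quantitatively void; nothing printed is a hypothesis; no `def`, no `def … : Prop`,
no `sorry`; axioms standard.  V-END with background ∕ NE2 NOT proved; NE3 OPEN; spine PROVED 0∕9 unchanged.  HONEST DEPENDENCY (cell, verbatim): continuum YM on T⁴ ⇐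
BetaPertH ∧ nine spine estimates (0/9 proved); BetaPertH ⇐ (D1) ∧ (D4) ∧ CAP+tail; G-an2-4 gates asym, D1 and NE2/3/4.
-/

noncomputable section

namespace Summit.QuantumFields.BalabanUV.T4Continuum.VariationalColourTaxiTransport

open Finset
open Literature.MathematicalPhysics.QuantumFieldTheory.Balaban1983to89.B5Prop11Plancherel (Tor fine unitVec)
open Literature.MathematicalPhysics.QuantumFieldTheory.Balaban1983to89.B5Block118 (bpt)
open Literature.MathematicalPhysics.QuantumFieldTheory.Balaban1983to89.B5Blocks16 (blockOf)
open Summit.QuantumFields.BalabanUV.T4Continuum.VariationalTransfer (blockSpin)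
open Summit.QuantumFields.BalabanUV.T4Continuum.VariationalColourFederbush (misv norm_le_one_of_mem_unitary)
open Summit.QuantumFields.BalabanUV.T4Continuum.VariationalColourTower (Rtrv)
open Summit.QuantumFields.BalabanUV.T4Continuum.VariationalColourUpperBound (nsqv nsqv_nonneg)
open Summit.QuantumFields.BalabanUV.T4Continuum.VariationalColourScalarPair
  (Scv Sfv qWv qVv Qkv Q1v Scv_nonneg Sfv_nonneg qWv_nonneg norm_sq_le_qWv norm_sq_le_qVv continuous_Qcv continuous_sum_dirUv Q1v_surjective)
open Summit.QuantumFields.BalabanUV.T4Continuum.VariationalColourPoincarePhys (qWv_le_coarse_local qVv_le_composite_local)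
open Summit.QuantumFields.BalabanUV.T4Continuum.VariationalColourOneStepPhys (rhov rhov_nonneg blockSpin_Q1v_le)
open Summit.QuantumFields.BalabanUV.T4Continuum.VariationalColourRegularityRho (hREG_rhov)
open Summit.QuantumFields.BalabanUV.T4Continuum.VariationalColourScalarPairClosed (hUBc_colour)
open Summit.QuantumFields.BalabanUV.T4Continuum.VariationalCovariantUpperSqrt (fine_ub_of_coarse_sqrt)

variable {d : ℕ}

/-! ## §1 The five colour leaves from data, as a bundle -/

section General

variable {E : Type*} [NormedAddCommGroup E] [InnerProductSpace ℂ E] [CompleteSpace E] [FiniteDimensional ℂ E]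
variable (n L : ℕ) [NeZero n] [NeZero L] (M : Fin d → ℕ) [hM : ∀ μ, NeZero (M μ)]

/-- **THE COLOUR SCALAR PAIR's LEAVES FROM DATA** (leaf-02-g5's `colour_pair_closed` chain, exported): UB⁺ and fine UB⁺ with the common constant `Λ`, P⁺ at both levels with
`C_P = 136`, REG⁺ with `C_R`, and `0 ≤ Λ`, `0 ≤ C_R`. [folklore] -/
theorem colour_leaves {Rc : Tor (fine n M) → Fin d → (E →L[ℂ] E)} {R' : Tor (fine L (fine n M)) → Fin d → (E →L[ℂ] E)}
    {T : Tor (fine n M) → (E →L[ℂ] E)} {T' : Tor (fine L (fine n M)) → (E →L[ℂ] E)}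
    (hT : ∀ x, T x ∈ unitary (E →L[ℂ] E)) (hRc : ∀ x μ, Rc x μ ∈ unitary (E →L[ℂ] E)) {w : ℝ} (hw0 : 0 ≤ w)
    (hw : ∀ (x : Tor (fine n M)) (μ : Fin d), blockOf n M (x + unitVec (fine n M) μ) = blockOf n M x →
      ‖Rc x μ * star (T (x + unitVec (fine n M) μ)) * T x - 1‖ ≤ w)
    (hsmall : 2 * (d : ℝ) * ((n : ℝ) * w) ^ 2 ≤ 1 / 2)
    {a : ℝ} (ha : 0 ≤ a)
    (hP : ∀ x μ ν, ‖Rc x μ * Rc (x + unitVec (fine n M) μ) ν - Rc x ν * Rc (x + unitVec (fine n M) ν) μ‖ ≤ a)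
    (hT' : ∀ x, T' x ∈ unitary (E →L[ℂ] E)) (hR' : ∀ x μ, ‖R' x μ‖ ≤ 1) {w' : ℝ}
    (hw' : ∀ (x : Tor (fine L (fine n M))) (μ : Fin d), blockOf L (fine n M) (x + unitVec (fine L (fine n M)) μ) = blockOf L (fine n M) x →
      ‖R' x μ * star (T' (x + unitVec (fine L (fine n M)) μ)) * T' x - 1‖ ≤ w')
    (hsmall' : 2 * (d : ℝ) * ((L : ℝ) * w') ^ 2 ≤ 1 / 2)
    {m : ℝ} (hm : 0 ≤ m) (hmis : ∀ y μ j, ‖misv L (fine n M) Rc R' T' y μ j‖ ≤ m) (habsorb : 64 * (d : ℝ) * ((n : ℝ) * m) ^ 2 ≤ 1 / 2)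
    {m₁ : ℝ} (hm₁ : 0 ≤ m₁)
    (hin : ∀ (y : Tor (fine n M)) (j : Fin d → Fin L) (μ : Fin d), (j μ : ℕ) + 1 < L →
      ‖R' (bpt L (fine n M) y j) μ * star (T' (bpt L (fine n M) y j + unitVec (fine L (fine n M)) μ)) - star (T' (bpt L (fine n M) y j))‖ ≤ m₁)
    (hcross : ∀ (y : Tor (fine n M)) (j : Fin d → Fin L) (μ : Fin d), (j μ : ℕ) + 1 = L →
      ‖R' (bpt L (fine n M) y j) μ * star (T' (bpt L (fine n M) y j + unitVec (fine L (fine n M)) μ))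
        - star (T' (bpt L (fine n M) y j)) * Rc y μ‖ ≤ m₁) :
    let Λc : ℝ := 2 * d * (36 : ℝ) ^ d * ((1 + n * w) ^ 2 + 9)
    let CP : ℝ := 136
    let CR : ℝ := 2 * Λc + 2 * d * (a * (n : ℝ) ^ 2) + (d : ℝ) ^ 2 * (a * (n : ℝ) ^ 2) ^ 2 * CP
    let ε₁ : ℝ := ((d : ℝ) / 4 + 1 / 2) * ((L : ℝ) / (n : ℝ) ^ 2)
    let δ' : ℝ := Real.sqrt (2 * d * (1 + (d : ℝ) ^ 2)) * ((n : ℝ) * L * m₁)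
    let Λ : ℝ := Λc + (ε₁ * CR + 2 * δ' * Real.sqrt ((1 + ε₁ * CR) * CP) + δ' ^ 2 * CP) * (Λc + 1)
    0 ≤ Λ ∧ 0 ≤ CR ∧
    (∀ ν : Tor M → E, ∃ f, Qkv n M T f = ν ∧ Scv n M Rc f ≤ Λ * nsqv ν) ∧
    (∀ ν : Tor M → E, ∃ f', Qkv n M T (Q1v n L M T' f') = ν ∧ Sfv n L M R' f' ≤ Λ * nsqv ν) ∧
    (∀ f, qWv n M f ≤ CP * (Scv n M Rc f + nsqv (Qkv n M T f))) ∧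
    (∀ f', qVv n L M f' ≤ CP * (Sfv n L M R' f' + nsqv (Qkv n M T (Q1v n L M T' f')))) ∧
    (∀ (ν : Tor M → E) f, Qkv n M T f = ν → (∀ g, Qkv n M T g = ν → Scv n M Rc f ≤ Scv n M Rc g) →
      rhov n M Rc f ≤ CR * (Scv n M Rc f + nsqv ν)) := by
  intro Λc CP CR ε₁ δ' Λ
  have hn0 : (0 : ℝ) < n := by exact_mod_cast Nat.pos_of_ne_zero (NeZero.ne n)
  have hL1 : (1 : ℝ) ≤ L := by exact_mod_cast Nat.one_le_iff_ne_zero.mpr (NeZero.ne L)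
  have hd : (0 : ℝ) ≤ d := Nat.cast_nonneg d
  have hΛc : 0 ≤ Λc := by positivity
  have hCP : 0 ≤ CP := by norm_num
  have hα : 0 ≤ a * (n : ℝ) ^ 2 := by positivity
  have hCR : 0 ≤ CR := by positivity
  have hε₁ : 0 ≤ ε₁ := by positivity
  have hδ' : 0 ≤ δ' := by positivity
  have hetil : 0 ≤ (ε₁ * CR + 2 * δ' * Real.sqrt ((1 + ε₁ * CR) * CP) + δ' ^ 2 * CP) * (Λc + 1) := by positivity
  have hΛ : 0 ≤ Λ := add_nonneg hΛc hetil
  -- UB⁺-colour at level n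
  have hUBc0 : ∀ ν : Tor M → E, ∃ f, Qkv n M T f = ν ∧ Scv n M Rc f ≤ Λc * nsqv ν := hUBc_colour n M hT hRc hw0 hw
  -- P⁺-colour at both levels
  have hPc : ∀ f, qWv n M f ≤ CP * (Scv n M Rc f + nsqv (Qkv n M T f)) := fun f => qWv_le_coarse_local n M hT hw hsmall f
  have hPf : ∀ f', qVv n L M f' ≤ CP * (Sfv n L M R' f' + nsqv (Qkv n M T (Q1v n L M T' f'))) := fun f' =>
    qVv_le_composite_local n L M hT hw hsmall hT' hw' hsmall' hR' hm hmis habsorb f'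
  -- ONE⁺-colour, square-root shape
  have hONE : ∀ f, blockSpin (Q1v n L M T') (Sfv n L M R') f
      ≤ (Real.sqrt (Scv n M Rc f + ε₁ * rhov n M Rc f) + δ' * Real.sqrt (qWv n M f)) ^ 2 := fun f =>
    blockSpin_Q1v_le n L M hT' hRc hm₁ hin hcross f
  -- REG⁺-colour
  have hREG : ∀ (ν : Tor M → E) f, Qkv n M T f = ν → (∀ g, Qkv n M T g = ν → Scv n M Rc f ≤ Scv n M Rc g) →
      rhov n M Rc f ≤ CR * (Scv n M Rc f + nsqv ν) := hREG_rhov n M hT hRc ha hP hΛc hUBc0 hPc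
  -- structure hypotheses
  have hnLd : (0 : ℝ) ≤ ((n : ℝ) * L) ^ d := by positivity
  have hnormW : ∀ f : Tor (fine n M) → E, ‖f‖ ^ 2 ≤ ((n : ℝ) * L) ^ d * qWv n M f := by
    intro f
    refine (norm_sq_le_qWv n M f).trans (mul_le_mul_of_nonneg_right ?_ (qWv_nonneg n M f))
    rw [mul_pow]
    exact le_mul_of_one_le_right (by positivity) (one_le_pow₀ hL1)
  have hnormV : ∀ f' : Tor (fine L (fine n M)) → E, ‖f'‖ ^ 2 ≤ ((n : ℝ) * L) ^ d * qVv n L M f' := norm_sq_le_qVv n L M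
  -- fine UB⁺ from the coarse one (leaf-01-g2's abstract bracket)
  have hUBf : ∀ ν : Tor M → E, ∃ f', Qkv n M T (Q1v n L M T' f') = ν ∧ Sfv n L M R' f' ≤ Λ * nsqv ν := by
    intro ν
    exact fine_ub_of_coarse_sqrt (V := Tor (fine L (fine n M)) → E) (W := Tor (fine n M) → E) (Z := Tor M → E)
      (Qk := Qkv n M T) (Q₁ := Q1v n L M T') (Sc := Scv n M Rc) (Sf := Sfv n L M R') (qW := qWv n M) (qV := qVv n L M) (qZ := nsqv)
      (ρ := rhov n M Rc) (continuous_Qcv T) (continuous_Qcv T') (continuous_sum_dirUv Rc _) (continuous_sum_dirUv R' _)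
      (Q1v_surjective n L M T' hT') (Scv_nonneg n M Rc) (Sfv_nonneg n L M R') (qWv_nonneg n M) (fun μ => nsqv_nonneg μ)
      (rhov_nonneg n M Rc) hnLd hnLd hΛc hCP hCR hε₁ hδ' hnormW hnormV hUBc0 hPc hPf hONE hREG ν
  have hUBc : ∀ ν : Tor M → E, ∃ f, Qkv n M T f = ν ∧ Scv n M Rc f ≤ Λ * nsqv ν := by
    intro ν
    obtain ⟨f, hf, hb⟩ := hUBc0 ν
    exact ⟨f, hf, hb.trans (mul_le_mul_of_nonneg_right (le_add_of_nonneg_right hetil) (nsqv_nonneg ν))⟩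
  exact ⟨hΛ, hCR, hUBc, hUBf, hPc, hPf, hREG⟩

end General

/-! ## §2 At Bałaban's taxi frames -/

section Taxi

variable (L : ℕ) [NeZero L] (M : Fin d → ℕ) [hM : ∀ μ, NeZero (M μ)]
variable {R' : (k : ℕ) → Tor (fine L (fine (L ^ k) M)) → Fin d → (ℂ →L[ℂ] ℂ)} (hU : ∀ k x μ, R' k x μ ∈ unitary (ℂ →L[ℂ] ℂ)) {b : ℕ → ℝ}
  (hb : ∀ k x κ ι, ‖R' k x κ * R' k (x + unitVec (fine L (fine (L ^ k) M)) κ) ι - R' k x ι * R' k (x + unitVec (fine L (fine (L ^ k) M)) ι) κ‖ ≤ b k)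
  (hcoh : ∀ k, coarseTv L (fine (L ^ (k + 1)) M) (R' (k + 1)) = Rtrv (L ^ k) L M (R' k))
include hU hb hcoh

/-- **THE COLOUR SCALAR PAIR's LEAVES AT BAŁABAN's TAXI FRAMES** (the courier's displayed colour leaves, letter for letter): `T := taxiTv (L^k) M (Rlev k)`,
`T′ := taxiTv L _ (R′ k)`, `Rc := Rlev k`, classes `w = (d−1)(L^k−1)a`, `w′ = (d−1)(L−1)b_k`, `m = (d−1)L(L−1)b_k`, `m₁ = (d−1)(L−1)(2L−1)b_k`. [folklore] -/
theorem colour_leaves_taxi (hM2 : ∀ μ, 1 < M μ) (k : ℕ) {a : ℝ} (ha0 : 0 ≤ a)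
    (ha : ∀ x κ ι, ‖Rlev L M R' k x κ * Rlev L M R' k (x + unitVec (fine (L ^ k) M) κ) ι - Rlev L M R' k x ι * Rlev L M R' k (x + unitVec (fine (L ^ k) M) ι) κ‖ ≤ a)
    (hb0 : 0 ≤ b k)
    (hsmallk : 2 * (d : ℝ) * ((((L ^ k : ℕ) : ℝ)) * (((d - 1 : ℕ) : ℝ) * ((L ^ k - 1 : ℕ) : ℝ) * a)) ^ 2 ≤ 1 / 2)
    (hsmallL : 2 * (d : ℝ) * ((L : ℝ) * (((d - 1 : ℕ) : ℝ) * ((L - 1 : ℕ) : ℝ) * b k)) ^ 2 ≤ 1 / 2)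
    (habsorb : 64 * (d : ℝ) * ((((L ^ k : ℕ) : ℝ)) * (((d - 1 : ℕ) : ℝ) * L * ((L - 1 : ℕ) : ℝ) * b k)) ^ 2 ≤ 1 / 2) :
    let Λc : ℝ := 2 * d * (36 : ℝ) ^ d * ((1 + ((L ^ k : ℕ) : ℝ) * (((d - 1 : ℕ) : ℝ) * ((L ^ k - 1 : ℕ) : ℝ) * a)) ^ 2 + 9)
    let CP : ℝ := 136
    let CR : ℝ := 2 * Λc + 2 * d * (a * (((L ^ k : ℕ) : ℝ)) ^ 2) + (d : ℝ) ^ 2 * (a * (((L ^ k : ℕ) : ℝ)) ^ 2) ^ 2 * CP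
    let ε₁ : ℝ := ((d : ℝ) / 4 + 1 / 2) * ((L : ℝ) / (((L ^ k : ℕ) : ℝ)) ^ 2)
    let δ' : ℝ := Real.sqrt (2 * d * (1 + (d : ℝ) ^ 2)) * ((((L ^ k : ℕ) : ℝ)) * L * (((d - 1 : ℕ) : ℝ) * ((L - 1 : ℕ) : ℝ) * ((2 * L - 1 : ℕ) : ℝ) * b k))
    let Λ : ℝ := Λc + (ε₁ * CR + 2 * δ' * Real.sqrt ((1 + ε₁ * CR) * CP) + δ' ^ 2 * CP) * (Λc + 1)
    0 ≤ Λ ∧ 0 ≤ CR ∧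
    (∀ ν : Tor M → ℂ, ∃ f, Qkv (L ^ k) M (taxiTv (L ^ k) M (Rlev L M R' k)) f = ν ∧ Scv (L ^ k) M (Rlev L M R' k) f ≤ Λ * nsqv ν) ∧
    (∀ ν : Tor M → ℂ, ∃ f', Qkv (L ^ k) M (taxiTv (L ^ k) M (Rlev L M R' k)) (Q1v (L ^ k) L M (taxiTv L (fine (L ^ k) M) (R' k)) f') = ν ∧
      Sfv (L ^ k) L M (R' k) f' ≤ Λ * nsqv ν) ∧
    (∀ f, qWv (L ^ k) M f ≤ CP * (Scv (L ^ k) M (Rlev L M R' k) f + nsqv (Qkv (L ^ k) M (taxiTv (L ^ k) M (Rlev L M R' k)) f))) ∧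
    (∀ f', qVv (L ^ k) L M f' ≤ CP * (Sfv (L ^ k) L M (R' k) f' + nsqv (Qkv (L ^ k) M (taxiTv (L ^ k) M (Rlev L M R' k)) (Q1v (L ^ k) L M (taxiTv L (fine (L ^ k) M) (R' k)) f')))) ∧
    (∀ (ν : Tor M → ℂ) f, Qkv (L ^ k) M (taxiTv (L ^ k) M (Rlev L M R' k)) f = ν →
      (∀ g, Qkv (L ^ k) M (taxiTv (L ^ k) M (Rlev L M R' k)) g = ν → Scv (L ^ k) M (Rlev L M R' k) f ≤ Scv (L ^ k) M (Rlev L M R' k) g) →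
      rhov (L ^ k) M (Rlev L M R' k) f ≤ CR * (Scv (L ^ k) M (Rlev L M R' k) f + nsqv ν)) := by
  have hR'all : ∀ k x μ, ‖R' k x μ‖ ≤ 1 := fun k x μ => norm_le_one_of_mem_unitary (hU k x μ)
  have hUk : ∀ x μ, Rlev L M R' k x μ ∈ unitary (ℂ →L[ℂ] ℂ) := Rlev_mem_unitary L M hU k
  have hT : ∀ x, taxiTv (L ^ k) M (Rlev L M R' k) x ∈ unitary (ℂ →L[ℂ] ℂ) := taxiTv_mem_unitary (L ^ k) M hUk
  have hT' : ∀ x, taxiTv L (fine (L ^ k) M) (R' k) x ∈ unitary (ℂ →L[ℂ] ℂ) := taxiTv_mem_unitary L (fine (L ^ k) M) (hU k)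
  have hC : coarseTv L (fine (L ^ k) M) (R' k) = Rlev L M R' k := coarseTv_eq_Rlev L M R' hcoh k
  -- the in-block classes in `blockOf` form at both levels
  have hw0 : 0 ≤ ((d - 1 : ℕ) : ℝ) * ((L ^ k - 1 : ℕ) : ℝ) * a := by positivity
  have hw := inBlock_blockOf_of_bpt (L ^ k) M hM2
    (P := fun x μ => ‖Rlev L M R' k x μ * star (taxiTv (L ^ k) M (Rlev L M R' k) (x + unitVec (fine (L ^ k) M) μ)) * taxiTv (L ^ k) M (Rlev L M R' k) x - 1‖
      ≤ ((d - 1 : ℕ) : ℝ) * ((L ^ k - 1 : ℕ) : ℝ) * a)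
    (fun y j μ hj => inBlock_defect_taxiTv_adjoint_le (L ^ k) M hUk ha y j μ hj)
  have hM2' : ∀ μ, 1 < fine (L ^ k) M μ := fun μ => by
    have h1 : 1 ≤ L ^ k := Nat.one_le_pow _ _ (NeZero.pos L)
    show 1 < L ^ k * M μ
    calc 1 < M μ := hM2 μ
      _ = 1 * M μ := (one_mul _).symm
      _ ≤ L ^ k * M μ := Nat.mul_le_mul_right _ h1
  have hw' := inBlock_blockOf_of_bpt L (fine (L ^ k) M) hM2'
    (P := fun x μ => ‖R' k x μ * star (taxiTv L (fine (L ^ k) M) (R' k) (x + unitVec (fine L (fine (L ^ k) M)) μ)) * taxiTv L (fine (L ^ k) M) (R' k) x - 1‖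
      ≤ ((d - 1 : ℕ) : ℝ) * ((L - 1 : ℕ) : ℝ) * b k)
    (fun y j μ hj => inBlock_defect_taxiTv_adjoint_le L (fine (L ^ k) M) (hU k) (hb k) y j μ hj)
  -- the transport mismatch and the one-step defects
  have hm0 : 0 ≤ ((d - 1 : ℕ) : ℝ) * L * ((L - 1 : ℕ) : ℝ) * b k := by positivity
  have hmis : ∀ y μ j, ‖misv L (fine (L ^ k) M) (Rlev L M R' k) (R' k) (taxiTv L (fine (L ^ k) M) (R' k)) y μ j‖ ≤ ((d - 1 : ℕ) : ℝ) * L * ((L - 1 : ℕ) : ℝ) * b k := by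
    intro y μ j
    have h := norm_misv_taxi_le L (fine (L ^ k) M) (hR'all k) (hb k) y μ j
    rw [hC] at h
    exact h
  have hm₁0 : 0 ≤ ((d - 1 : ℕ) : ℝ) * ((L - 1 : ℕ) : ℝ) * ((2 * L - 1 : ℕ) : ℝ) * b k := by positivity
  have hin : ∀ (y : Tor (fine (L ^ k) M)) (j : Fin d → Fin L) (μ : Fin d), (j μ : ℕ) + 1 < L →
      ‖R' k (bpt L (fine (L ^ k) M) y j) μ * star (taxiTv L (fine (L ^ k) M) (R' k) (bpt L (fine (L ^ k) M) y j + unitVec (fine L (fine (L ^ k) M)) μ))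
        - star (taxiTv L (fine (L ^ k) M) (R' k) (bpt L (fine (L ^ k) M) y j))‖ ≤ ((d - 1 : ℕ) : ℝ) * ((L - 1 : ℕ) : ℝ) * ((2 * L - 1 : ℕ) : ℝ) * b k := by
    intro y j μ hj
    refine (hin_taxiTv_le L (fine (L ^ k) M) (hU k) (hb k) y j μ hj).trans ?_
    have hL1 : (1 : ℝ) ≤ ((2 * L - 1 : ℕ) : ℝ) := by
      have := NeZero.pos L
      exact_mod_cast (by omega : 1 ≤ 2 * L - 1)
    have h0 : 0 ≤ ((d - 1 : ℕ) : ℝ) * ((L - 1 : ℕ) : ℝ) * b k := by positivity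
    calc ((d - 1 : ℕ) : ℝ) * ((L - 1 : ℕ) : ℝ) * b k = (((d - 1 : ℕ) : ℝ) * ((L - 1 : ℕ) : ℝ) * b k) * 1 := (mul_one _).symm
      _ ≤ (((d - 1 : ℕ) : ℝ) * ((L - 1 : ℕ) : ℝ) * b k) * ((2 * L - 1 : ℕ) : ℝ) := mul_le_mul_of_nonneg_left hL1 h0
      _ = ((d - 1 : ℕ) : ℝ) * ((L - 1 : ℕ) : ℝ) * ((2 * L - 1 : ℕ) : ℝ) * b k := by ring
  have hcross : ∀ (y : Tor (fine (L ^ k) M)) (j : Fin d → Fin L) (μ : Fin d), (j μ : ℕ) + 1 = L →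
      ‖R' k (bpt L (fine (L ^ k) M) y j) μ * star (taxiTv L (fine (L ^ k) M) (R' k) (bpt L (fine (L ^ k) M) y j + unitVec (fine L (fine (L ^ k) M)) μ))
        - star (taxiTv L (fine (L ^ k) M) (R' k) (bpt L (fine (L ^ k) M) y j)) * Rlev L M R' k y μ‖ ≤ ((d - 1 : ℕ) : ℝ) * ((L - 1 : ℕ) : ℝ) * ((2 * L - 1 : ℕ) : ℝ) * b k := by
    intro y j μ hj
    have h := hcross_taxiTv_le L (fine (L ^ k) M) (hU k) (hb k) y j μ hj
    rw [hC] at h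
    exact h
  exact colour_leaves (L ^ k) L M hT hUk hw0 hw hsmallk ha0 ha hT' (hR'all k) hw' hsmallL hm0 hmis habsorb hm₁0 hin hcross

end Taxi

end Summit.QuantumFields.BalabanUV.T4Continuum.VariationalColourTaxiTransport

end
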